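import Literature.Computability.Cryptography.SISSolverParams
import Literature.Computability.Complexity.IterateFPPoly
import Literature.Computability.Complexity.StackBricksStrings
import HarnessLib

/-!
# The SIS′ solver is polynomial-time, II: reading the key bits off the instance (`SIS.keyOf ∈ FP`)

Second brick file of the discharge of `Literature.Computability.Cryptography.sisSolver_polyTime`
(`SISFunctionSolver.lean`), continuing `SISSolverParams.lean`. The solver reads the key bits of an
instance code syntactically: `SIS.keyOf inp = SIS.keyBitsWith n (width n) (bitWidth n) inp`,
`n = SIS.nOf inp`, the concatenation over the `n · width n` positions `c` (row `c / m`, column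
`c % m`) of the entry numerals `SIS.entryCode inp i j` (items of the framed list of items of the
framed payload, `SIS.itemAt`) each padded/truncated to `bitWidth n` bits (`SIS.padTo`). Here this
function is realised as a counted loop of `FP` string functions (`Brick.loopStep`,
`Brick.loopFn_mem_FP_of_poly` of `IterateFPPoly.lean`):

* `keyItem inp c` — the `c`-th item `padTo t (entryCode inp (c / m) (c % m))`;
* `keyBody` — one round on the record `⟨inp, ⟨counter, ⟨1ᶜ, acc⟩⟩⟩`: the state becomes
  `⟨1ᶜ⁺¹, acc ++ keyItem inp c⟩` (`keyBody_apply`; row/column by `Plumb.divModFn`, items by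
  `HashBricks.nthItemFn`, padding by `padTakeFn`); it grows the state by `bitWidth n + 4 ≤
  16 (|inp| + 2) + 4` symbols whatever the record (`length_keyBody_le`), so the loop is in `FP`;
* `keyFn` — initialise `⟨inp, ⟨encodeNat (n m), ⟨ε, ε⟩⟩⟩`, run `32 (|inp| + 2)³ ≥ n m` rounds, read
  the accumulator: **`keyFn inp = SIS.keyOf inp` on every string** (`keyFn_apply`) and
  `keyFn ∈ FP` (`keyFn_mem_FP`).

## References

* S. Arora, B. Barak, *Computational Complexity: A Modern Approach*, CUP 2009, §1.3 (polynomial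
  time is closed under composition and bounded loops), §0.1 (representations).
* O. Goldreich, *Foundations of Cryptography I*, CUP 2001, §2.4.2 (reading a key of a collection
  off its description).
-/

noncomputable section

namespace Literature.Computability.Cryptography.SIS.SolverFP

open _root_.Computability Polynomial Literature.Computability.Complexity Brick Plumb HashBricks OracleCompose

/-! ### Framed lists: `itemAt` is `nthItemFn` -/

/-- `unpN i F = sndF^{i} F`. [folklore] -/
theorem unpN_eq_iterate : ∀ (i : ℕ) (F : List Bool), unpN i F = sndF^[i] F
  | 0, _ => rfl
  | i + 1, F => by
    rw [unpN, unpN_eq_iterate i, Function.iterate_succ_apply]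
    rfl

/-- `itemAt i F = fstF (sndF^{i} F)`. [folklore] -/
theorem itemAt_eq (i : ℕ) (F : List Bool) : itemAt i F = fstF (sndF^[i] F) := by
  rw [itemAt, unpN_eq_iterate]
  rfl

/-- `nthItemFn ⟨1ⁱ, F⟩ = itemAt i F`. [folklore] -/
theorem nthItemFn_ones (i : ℕ) (F : List Bool) : nthItemFn (boolPair (ones i) F) = itemAt i F := by
  rw [nthItemFn_boolPair, List.length_replicate, itemAt_eq]

/-- `padTo t e` is `List.takeD t e false`. [folklore] -/
theorem padTo_eq_takeD : ∀ (t : ℕ) (e : List Bool), padTo t e = List.takeD t e false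
  | 0, e => by simp [padTo]
  | t + 1, [] => by simp [padTo, List.replicate_succ]
  | t + 1, a :: e => by
    have ih := padTo_eq_takeD t e
    simp only [padTo, List.cons_append, List.take_succ_cons, List.takeD_succ, List.head?_cons,
      Option.getD_some, List.tail_cons, List.cons.injEq, true_and] at ih ⊢
    rw [← ih, List.replicate_succ', ← List.append_assoc, List.take_append_of_le_length]
    simp

/-- The framed list of row codes of an instance: `rowsOf inp = (boolUnpair (payloadOf inp)).2`. [folklore] -/
def rowsOf : List Bool → List Bool := sndP ∘ sndP ∘ sndP ∘ sndP

/-- Value of `rowsOf`. [folklore] -/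
theorem rowsOf_apply (inp : List Bool) : rowsOf inp = (boolUnpair (payloadOf inp)).2 := rfl

/-- `rowsOf ∈ FP`. [folklore] -/
theorem rowsOf_mem_FP : rowsOf ∈ FP :=
  comp_mem_FP sndP_mem_FP (comp_mem_FP sndP_mem_FP (comp_mem_FP sndP_mem_FP sndP_mem_FP))

/-! ### One round: append the next padded entry -/

/-- The `c`-th item of the key: the entry at row `c / m`, column `c % m`, padded/truncated to
`bitWidth n` bits (`n = nOf inp`, `m = width n`). [folklore] -/
def keyItem (inp : List Bool) (c : ℕ) : List Bool :=
  padTo (bitWidth (nOf inp)) (entryCode inp (c / width (nOf inp)) (c % width (nOf inp)))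

/-- `keyOf` is the concatenation of the items. [folklore] -/
theorem keyOf_eq_flatMap (inp : List Bool) :
    keyOf inp = (List.range (nOf inp * width (nOf inp))).flatMap (keyItem inp) := rfl

/-- Row and column of the current position, in unary: `⟨1^{c / m}, 1^{c % m}⟩` from the record
`⟨inp, ⟨counter, ⟨1ᶜ, acc⟩⟩⟩`. [folklore] -/
def ijF : List Bool → List Bool := divModFn ∘ fanoutFn (mU ∘ nU ∘ nthF 0) (nthF 2)

/-- The current entry numeral `entryCode inp (c / m) (c % m)`. [folklore] -/
def entryF : List Bool → List Bool :=
  nthItemFn ∘ fanoutFn (sndF ∘ ijF) (sndF ∘ nthItemFn ∘ fanoutFn (fstF ∘ ijF) (rowsOf ∘ nthF 0))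

/-- The current entry padded/truncated to `bitWidth n` bits. [folklore] -/
def padF : List Bool → List Bool := fstF ∘ padTakeFn ∘ fanoutFn (tU ∘ nU ∘ nthF 0) entryF

/-- **One round of the key extraction**: the new state `⟨1ᶜ⁺¹, acc ++ keyItem inp c⟩`. [folklore] -/
def keyBody : List Bool → List Bool :=
  fanoutFn (List.cons true ∘ nthF 2) (concatFn ∘ fanoutFn (sndPow 2) padF)

/-- `ijF ∈ FP`. [folklore] -/
theorem ijF_mem_FP : ijF ∈ FP :=
  comp_mem_FP divModFn_mem_FP (fanoutFn_mem_FP (comp_mem_FP mU_mem_FP (comp_mem_FP nU_mem_FP (nthF_mem_FP 0))) (nthF_mem_FP 2))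

/-- `entryF ∈ FP`. [folklore] -/
theorem entryF_mem_FP : entryF ∈ FP :=
  comp_mem_FP nthItemFn_mem_FP (fanoutFn_mem_FP (comp_mem_FP sndF_mem_FP ijF_mem_FP)
    (comp_mem_FP sndF_mem_FP (comp_mem_FP nthItemFn_mem_FP
      (fanoutFn_mem_FP (comp_mem_FP fstF_mem_FP ijF_mem_FP) (comp_mem_FP rowsOf_mem_FP (nthF_mem_FP 0))))))

/-- `padF ∈ FP`. [folklore] -/
theorem padF_mem_FP : padF ∈ FP :=
  comp_mem_FP fstF_mem_FP (comp_mem_FP padTakeFn_mem_FP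
    (fanoutFn_mem_FP (comp_mem_FP tU_mem_FP (comp_mem_FP nU_mem_FP (nthF_mem_FP 0))) entryF_mem_FP))

/-- `keyBody ∈ FP`. [folklore] -/
theorem keyBody_mem_FP : keyBody ∈ FP :=
  fanoutFn_mem_FP (comp_mem_FP (cons_mem_FP true) (nthF_mem_FP 2))
    (comp_mem_FP concatFn_mem_FP (fanoutFn_mem_FP (sndPow_mem_FP 2) padF_mem_FP))

/-- **Value of one round** on a well-formed record. [folklore] -/
theorem keyBody_apply (inp cnt acc : List Bool) (c : ℕ) :
    keyBody (boolPair inp (boolPair cnt (boolPair (ones c) acc))) = boolPair (ones (c + 1)) (acc ++ keyItem inp c) := by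
  have hij : ijF (boolPair inp (boolPair cnt (boolPair (ones c) acc))) =
      boolPair (ones (c / width (nOf inp))) (ones (c % width (nOf inp))) := by
    simp [ijF, nthF, ones]
  have hentry : entryF (boolPair inp (boolPair cnt (boolPair (ones c) acc))) =
      entryCode inp (c / width (nOf inp)) (c % width (nOf inp)) := by
    simp only [entryF, Function.comp_apply, fanoutFn_apply, hij, fstF_boolPair, sndF_boolPair, nthItemFn_ones]
    simp [nthF, rowsOf_apply, entryCode, sndF]
  have hpad : padF (boolPair inp (boolPair cnt (boolPair (ones c) acc))) = keyItem inp c := by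
    simp only [padF, Function.comp_apply, fanoutFn_apply, hentry, padTakeFn_boolPair, fstF_boolPair, keyItem,
      padTo_eq_takeD]
    simp [nthF, ones]
  simp only [keyBody, fanoutFn_apply, Function.comp_apply, hpad]
  simp [nthF, sndPow, ones, List.replicate_succ]

/-- `nOf inp ≤ |inp|`. [folklore] -/
theorem nOf_le_length (inp : List Bool) : nOf inp ≤ inp.length := by
  unfold nOf payloadOf
  have h1 := length_boolUnpair_parts_le inp
  have h2 := length_boolUnpair_parts_le (boolUnpair inp).2
  have h3 := length_boolUnpair_parts_le (boolUnpair (boolUnpair inp).2).2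
  have h4 := length_boolUnpair_parts_le (boolUnpair (boolUnpair (boolUnpair inp).2).2).2
  omega

/-- `logLen n ≤ n + 2` (sharper than `SIS.logLen_le : logLen n ≤ 2 n + 4` of `SISFunction.lean`). [folklore] -/
theorem logLen_le_add_two (n : ℕ) : logLen n ≤ n + 2 := by
  rw [← size_add_two]; exact Nat.size_le.2 Nat.lt_two_pow_self

/-- `bitWidth n ≤ 16 (n + 2)`. [folklore] -/
theorem bitWidth_le (n : ℕ) : bitWidth n ≤ 16 * (n + 2) := by
  unfold bitWidth; have := logLen_le_add_two n; omega

/-- `width n ≤ 32 (n + 2)²`. [folklore] -/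
theorem width_le (n : ℕ) : width n ≤ 32 * (n + 2) ^ 2 := by
  unfold width; have := bitWidth_le n; nlinarith

/-- **Growth of one round**: `|keyBody z| ≤ |sndPow 1 z| + (16 (|fstF z| + 2) + 4)` on every
record `z` (the padded entry has exactly `bitWidth (nOf (fstF z))` bits). [folklore] -/
theorem length_keyBody_le (z : List Bool) :
    (keyBody z).length ≤ (sndPow 1 z).length + (16 * (X + 2) + 4 : Polynomial ℕ).eval (fstF z).length := by
  have hpad : (padF z).length = bitWidth (nOf (fstF z)) := by
    simp [padF, nthF, ones]
  have hst := length_nthF_succ_add_sndPow_succ_le 1 z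
  have hbw := bitWidth_le (nOf (fstF z))
  have hn := nOf_le_length (fstF z)
  simp only [keyBody, fanoutFn_apply, Function.comp_apply, length_boolPair, List.length_cons, List.length_append,
    concatFn_boolPair, hpad, eval_add, eval_mul, eval_ofNat, eval_X]
  nlinarith

/-! ### The loop -/

/-- The number of rounds: `32 (|inp| + 2)³ ≥ n · width n`. [folklore] -/
def keyRounds : Polynomial ℕ := 32 * (X + 2) ^ 3

/-- `n · width n ≤ keyRounds (|inp|)`. [folklore] -/
theorem mul_width_le_keyRounds (inp : List Bool) : nOf inp * width (nOf inp) ≤ keyRounds.eval inp.length := by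
  have hn := nOf_le_length inp
  have hw := width_le (nOf inp)
  simp only [keyRounds, eval_mul, eval_pow, eval_add, eval_X, eval_ofNat]
  calc nOf inp * width (nOf inp) ≤ (inp.length + 2) * (32 * (inp.length + 2) ^ 2) := by
        refine Nat.mul_le_mul (by omega) (hw.trans ?_)
        exact Nat.mul_le_mul_left _ (Nat.pow_le_pow_left (by omega) 2)
    _ = 32 * (inp.length + 2) ^ 3 := by ring

/-- The counted loop of `keyBody`, clocked at `keyRounds (|inp|)` rounds. [folklore] -/
def keyLoop (z : List Bool) : List Bool := (loopStep keyBody)^[keyRounds.eval (fstF z).length] z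

/-- `keyLoop ∈ FP` (a counted loop whose rounds grow polynomially, `loopFn_mem_FP_of_poly`). [folklore] -/
theorem keyLoop_mem_FP : keyLoop ∈ FP :=
  loopFn_mem_FP_of_poly keyBody_mem_FP (16 * (X + 2) + 4) length_keyBody_le keyRounds

/-- The initial record `⟨inp, ⟨encodeNat (n · width n), ⟨ε, ε⟩⟩⟩`. [folklore] -/
def keyInit : List Bool → List Bool :=
  fanoutFn (fun w => w) (fanoutFn (bmulFn (nB ∘ nU) (widthFn ∘ nU)) fun _ => boolPair [] [])

/-- Value of `keyInit`. [folklore] -/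
theorem keyInit_apply (inp : List Bool) :
    keyInit inp = boolPair inp (boolPair (encodeNat (nOf inp * width (nOf inp))) (boolPair [] [])) := by
  simp [keyInit, ones, widthFn]

/-- `keyInit ∈ FP`. [folklore] -/
theorem keyInit_mem_FP : keyInit ∈ FP :=
  fanoutFn_mem_FP id_mem_FP (fanoutFn_mem_FP (bmulFn_mem_FP (comp_mem_FP nB_mem_FP nU_mem_FP) (comp_mem_FP widthFn_mem_FP nU_mem_FP))
    (const_mem_FP _))

/-- **The loop invariant**: `k` rounds from `⟨1ᶜ, acc⟩` append the items `c, …, c + k - 1`. [folklore] -/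
theorem loopModel_keyBody (inp : List Bool) : ∀ (k c : ℕ) (acc : List Bool),
    loopModel keyBody inp k (boolPair (ones c) acc) =
      boolPair (ones (c + k)) (acc ++ (List.range' c k).flatMap (keyItem inp))
  | 0, c, acc => by simp [loopModel]
  | k + 1, c, acc => by
    rw [loopModel, keyBody_apply, loopModel_keyBody inp k (c + 1), List.range'_succ, List.flatMap_cons,
      List.append_assoc, show c + 1 + k = c + (k + 1) by omega]

/-- **The key extraction as a string function**: initialise, loop, read the accumulator. [folklore] -/
def keyFn : List Bool → List Bool := sndPow 2 ∘ keyLoop ∘ keyInit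

/-- `keyFn ∈ FP`. [folklore] -/
theorem keyFn_mem_FP : keyFn ∈ FP := comp_mem_FP (sndPow_mem_FP 2) (comp_mem_FP keyLoop_mem_FP keyInit_mem_FP)

/-- **`keyFn inp = SIS.keyOf inp` on every string.** [folklore] -/
theorem keyFn_apply (inp : List Bool) : keyFn inp = keyOf inp := by
  have hrounds := mul_width_le_keyRounds inp
  simp only [keyFn, Function.comp_apply, keyLoop, keyInit_apply, fstF_boolPair]
  rw [iterate_loopStep keyBody inp _ _ _ hrounds]
  have h := loopModel_keyBody inp (nOf inp * width (nOf inp)) 0 []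
  simp only [ones, List.replicate_zero, List.nil_append, zero_add] at h
  rw [h, keyOf_eq_flatMap, List.range_eq_range']
  simp [sndPow]

end Literature.Computability.Cryptography.SIS.SolverFP

end
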